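/-
Copyright (c) 2026 the pub-hodgecm-mathlib formalisation cell (harness21).  Prover seat hodgecm-mathlib-K2E5-p17 (g3) (free E5 hand on the E3 road),
Track B «K2-LIT» ∕ h413 (`stmt-HodgeConjecture-24833`), line `K2_E3_EllipticInputs`, unit U12-d, §L: brick (A) of the Lie–Weyl road (b-ii) to the leaf
(LBGL-2b) — the Haar measure of `GL₂(𝒪)` over its two Bruhat cells `N⁻(𝒪)·B(𝒪) ⊔ n(𝔭) w·B(𝒪)`.  2026-09-04.
-/
import Summits.HodgeConjecture.HodgeConjecture.Theorems.K2E3GL2IntegralPointsCellLemmas   -- ★ LEMMAS (this seat): cell algebra in `GL₂(𝒪)`, the `𝒪`-averaging lemma; brings ★ (b-i), ★ `glInt` kit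
import HarnessLib

/-!
# K2_E3 road (h413), §L — (LBGL-2b) brick (A): Haar measure of `K = GL₂(𝒪)` over the two Bruhat cells

Cell `pub/hodgecm-mathlib` (D-0151), Track B, seat K2E5-p17 (g3) (§L lead K2E3-p12 (g4) RULINGS #1 (SL-2) ∕ #3 (SL-9): «(A) = K2E5-p17 (g3)»; consumer
K2E5-p10 (g4), bricks (C)(D) of (b-ii)).  `--supports stmt-HodgeConjecture-24833 --as helper`; THEOREMS ONLY (no definition ∕ instance ∕ notation ∕ named fact ∕ `sorry`);
never imports `Cruxes/…/Lines`.  COUNT-NEUTRAL.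

THE STATEMENT.  `K = GL₂(𝒪) ⊂ GL₂(F)` (`F` a non-archimedean local field, ★ `glInt 2 F`), `κ` a Haar measure on `K`, `dx` an additive Haar measure on `F`,
`B(𝒪) = {b ∈ K : b₁₀ = 0}` the integral upper Borel.  `K` is the disjoint union of the two compact-open «cells»
`K₁ = {k : |k₀₀| = 1} = {n⁻(s) b : s ∈ 𝒪, b ∈ B(𝒪)}` (`n⁻(s) = [[1,0],[s,1]]`) and `K₂ = {k : |k₀₀| < 1} = {w(t) b : t ∈ 𝔭, b ∈ B(𝒪)}` (`w(t) = [[t,1],[1,0]] = n(t) w`),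
with cell coordinates `s = k₁₀ ∕ k₀₀`, `t = k₀₀ ∕ k₁₀` constant along right `B(𝒪)`-cosets.  THEN there is ONE constant `c = κ(K₁) ∕ dx(𝒪) ∈ (0, ∞)` with, for every measurable
right-`B(𝒪)`-invariant `Ψ : GL₂(F) → [0, ∞]`,
  **`∫⁻_K Ψ dκ = c · ( ∫⁻_{s ∈ 𝒪} Ψ(n⁻(s)) dx + ∫⁻_{t ∈ 𝔭} Ψ(w(t)) dx )`**
(`lintegral_glInt_eq_bruhatCells`; the parametrisations `n⁻`, `w(·)` enter only through their matrices, so the consumer supplies his own measurable `GL₂(F)`-valued spellings;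
§4 `lintegral_glInt_eq_bruhatCells_mkOfDetNeZero` is the same with `Matrix.GeneralLinearGroup.mkOfDetNeZero` spellings and their continuity `continuous_lowerUniGL` ∕ `continuous_swapTGL`).
PROOF (no Jacobian, no `p`-adic analysis): (i) `Ψ(k) = Ψ(n⁻(s(k)))` on `K₁` and `Ψ(k) = Ψ(w(t(k)))` on `K₂` (right `B(𝒪)`-invariance; `n⁻(s)⁻¹ k`, `w(t)⁻¹ k` are upper
triangular IN `K`); (ii) the push-forward `s_*(κ|_{K₁})` is a finite measure on `F` carried by `𝒪` and invariant under translation by `𝒪` (left multiplication by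
`n⁻(x) ∈ K` preserves `κ` and `K₁` and shifts `s` by `x`), hence `= c · dx|_𝒪` by the AVERAGING LEMMA `eq_smul_restrict_of_forall_map_add_eq` (Tonelli:
`m(A)·dx(𝒪) = m(𝒪)·dx(A ∩ 𝒪)` — the additive, compact-open-subgroup case of ★ `HaarLocalChart`); (iii) `t_*(κ|_{K₂}) = (s_*(κ|_{K₁}))|_𝔭` by the flip `k ↦ w k`
(`w = [[0,1],[1,0]] ∈ K` maps `{k ∈ K₁ : s(k) ∈ 𝔭}` onto `K₂` with `t(wk) = s(k)`), so the SAME constant serves both cells; (iv) `∫⁻_K = ∫⁻_{K₁} + ∫⁻_{K₂}` and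
`lintegral_map`.
[Serre1980Trees, Ch. II §1.1 (the `q + 1` cosets `K ∕ I` and the cells of `K ∕ B(𝒪) = ℙ¹(𝒪)`)] [IwahoriMatsumoto1965, §2 Prop. 2.4] [Folland1995, §2.2 Thm. 2.20 (Haar
uniqueness), §2.6] [HarishChandra1999AdmissibleDistributions, Lemma 7.8 (the `K × 𝔟` form of split orbital integrals)].
HONEST LABEL: HC_CM is proved only modulo the 7 printed citations (2 remaining named inputs: hLiu418 = stmt-HodgeConjecture-24832, h413 = stmt-HodgeConjecture-24833)
until rung 0 closes; count-neutral helper ((LBGL-2b) still owes (b-ii) = (Q)(C)(D) of K2E5-p10 (g4)).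
-/

set_option autoImplicit false
set_option linter.dupNamespace false   -- `Summit.HodgeConjecture.HodgeConjecture.…` (D-0017 nested layout; lakefile exemption for Summits)

noncomputable section

open MeasureTheory Measure Filter Topology Set
open scoped MatrixGroups NNReal ENNReal Pointwise ValuativeRel
open ValuativeRel
open Literature.NumberTheory.Rogawski1990 Literature.NumberTheory.Automorphic Literature.NumberTheory.Automorphic.LocalFieldHaar
open Literature.NumberTheory.GaloisRepresentations Literature.NumberTheory.GaloisRepresentations.IsNonarchimedeanLocalField
open Summit.HodgeConjecture.HodgeConjecture.Cruxes.H413.K2E3GL2IntegralPointsCellLemmas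

namespace Summit.HodgeConjecture.HodgeConjecture.Cruxes.H413.K2E3GL2IntegralPointsBruhatCells

variable {F : Type*} [Field F] [ValuativeRel F]

/-! ## §1  THE HEAD: `∫⁻_K Ψ dκ = c · (∫⁻_{𝒪} Ψ(n⁻ s) ds + ∫⁻_{𝔭} Ψ(w(t)) dt)` -/

section Cells
variable [TopologicalSpace F] [IsNonarchimedeanLocalField F] [MeasurableSpace F] [BorelSpace F]
  [MeasurableSpace (GL (Fin 2) F)] [BorelSpace (GL (Fin 2) F)]

/-- **BRUHAT-CELL INTEGRATION ON `K = GL₂(𝒪)`.**  For a Haar measure `κ` on `K = ↥(glInt 2 F)` and an additive Haar measure `dx` on `F` there is ONE constant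
`c ∈ (0, ∞)` (`= κ{k : |k₀₀| = 1} ∕ dx(𝒪)`) such that: for ALL measurable parametrisations `nl, nw : F → GL₂(F)` with matrices `nl s = [[1,0],[s,1]]`,
`nw t = [[t,1],[1,0]]`, and every measurable `Ψ : GL₂(F) → [0,∞]` which is right-invariant under the integral Borel
`B(𝒪) = {b ∈ K : b₁₀ = 0}` on `K` (`Ψ(k b) = Ψ(k)` for `k, b ∈ K`, `b₁₀ = 0`),
  `∫⁻ k, Ψ k dκ = c · ( ∫⁻ s in 𝒪, Ψ (nl s) dx + ∫⁻ t in 𝔭, Ψ (nw t) dx )`  (`𝒪 = primePowBall F 0`, `𝔭 = primePowBall F 1`).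
The two terms are the cells `K₁ = N⁻(𝒪) B(𝒪)` (`|k₀₀| = 1`, coordinate `s = k₁₀ ∕ k₀₀`) and `K₂ = n(𝔭) w B(𝒪)` (`|k₀₀| < 1`, coordinate `t = k₀₀ ∕ k₁₀`) of
`K ∕ B(𝒪) = ℙ¹(𝒪)`; the one constant for both comes from the flip `k ↦ w k`.
[cite: Serre1980Trees, Ch. II §1.1] [cite: IwahoriMatsumoto1965, §2 Prop. 2.4] [cite: Folland1995, §2.2 Thm. 2.20, §2.6 Thm. 2.49] -/
theorem lintegral_glInt_eq_bruhatCells (κ : Measure ↥(glInt 2 F)) [κ.IsHaarMeasure] (dx : Measure F) [dx.IsAddHaarMeasure] :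
    ∃ c : ℝ≥0∞, c ≠ 0 ∧ c ≠ ⊤ ∧
      ∀ (nl : F → GL (Fin 2) F), (∀ s, ((nl s : GL (Fin 2) F) : Matrix (Fin 2) (Fin 2) F) = !![1, 0; s, 1]) → Measurable nl →
      ∀ (nw : F → GL (Fin 2) F), (∀ t, ((nw t : GL (Fin 2) F) : Matrix (Fin 2) (Fin 2) F) = !![t, 1; 1, 0]) → Measurable nw →
      ∀ Ψ : GL (Fin 2) F → ℝ≥0∞, Measurable Ψ →
        (∀ k ∈ glInt 2 F, ∀ b ∈ glInt 2 F, ((b : GL (Fin 2) F) : Matrix (Fin 2) (Fin 2) F) 1 0 = 0 → Ψ (k * b) = Ψ k) →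
        ∫⁻ k, Ψ (k : GL (Fin 2) F) ∂κ =
          c * ((∫⁻ s in primePowBall F 0, Ψ (nl s) ∂dx) + ∫⁻ t in primePowBall F 1, Ψ (nw t) ∂dx) := by
  haveI : T2Space F := (isLocalField F).toT2Space
  haveI : LocallyCompactSpace F := (isLocalField F).toLocallyCompactSpace
  haveI : SecondCountableTopology F := secondCountableTopology_localField F
  haveI : BorelSpace ↥(glInt 2 F) := Subtype.borelSpace _
  haveI : CompactSpace ↥(glInt 2 F) := isCompact_iff_compactSpace.1 (isCompact_glInt 2 F)
  haveI : IsFiniteMeasure κ := CompactSpace.isFiniteMeasure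
  -- the two matrix-entry coordinates on `K`
  set e00 : ↥(glInt 2 F) → F := fun k => ((k : GL (Fin 2) F) : Matrix (Fin 2) (Fin 2) F) 0 0 with he00
  set e10 : ↥(glInt 2 F) → F := fun k => ((k : GL (Fin 2) F) : Matrix (Fin 2) (Fin 2) F) 1 0 with he10
  have hcoe : Continuous fun k : ↥(glInt 2 F) => ((k : GL (Fin 2) F) : Matrix (Fin 2) (Fin 2) F) :=
    Units.continuous_val.comp continuous_subtype_val
  have he00c : Continuous e00 := hcoe.matrix_elem 0 0
  have he10c : Continuous e10 := hcoe.matrix_elem 1 0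
  -- the cells
  set K₂ : Set ↥(glInt 2 F) := e00 ⁻¹' primePowBall F 1 with hK₂
  have hK₂m : MeasurableSet K₂ := ((isClosed_primePowBall 1).preimage he00c).measurableSet
  have hK₁m : MeasurableSet K₂ᶜ := hK₂m.compl
  have hmemK₂ : ∀ k : ↥(glInt 2 F), k ∈ K₂ ↔ valuation F (e00 k) < 1 := fun k => by
    rw [hK₂, Set.mem_preimage, mem_primePowBall_one_iff]
  -- on `K₁ = K₂ᶜ`, `|k₀₀| = 1` (so `k₀₀ ≠ 0`); on `K₂`, `|k₁₀| = 1`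
  have hK₁unit : ∀ k : ↥(glInt 2 F), k ∈ K₂ᶜ → valuation F (e00 k) = 1 := fun k hk =>
    le_antisymm (valuation_apply_le_one k.2 0 0) (not_lt.1 (fun h => hk ((hmemK₂ k).2 h)))
  have hK₂unit : ∀ k : ↥(glInt 2 F), k ∈ K₂ → valuation F (e10 k) = 1 := fun k hk =>
    valuation_apply_one_zero_eq_one k.2 ((hmemK₂ k).1 hk)
  have hne00 : ∀ k : ↥(glInt 2 F), k ∈ K₂ᶜ → e00 k ≠ 0 := fun k hk h0 => by
    have := hK₁unit k hk; rw [h0, map_zero] at this; exact zero_ne_one this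
  have hne10 : ∀ k : ↥(glInt 2 F), k ∈ K₂ → e10 k ≠ 0 := fun k hk h0 => by
    have := hK₂unit k hk; rw [h0, map_zero] at this; exact zero_ne_one this
  -- the cell coordinates
  set σ : ↥(glInt 2 F) → F := fun k => e10 k / e00 k with hσ
  set τ : ↥(glInt 2 F) → F := fun k => e00 k / e10 k with hτ
  have hσm : Measurable σ := he10c.measurable.div he00c.measurable
  have hτm : Measurable τ := he00c.measurable.div he10c.measurable
  have hσO : ∀ k : ↥(glInt 2 F), k ∈ K₂ᶜ → σ k ∈ primePowBall F 0 := fun k hk => by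
    rw [LocalFieldHaar.mem_primePowBall_zero_iff, Valuation.mem_integer_iff, hσ]
    simp only
    rw [map_div₀, hK₁unit k hk, div_one]
    exact valuation_apply_le_one k.2 1 0
  -- the swap `w ∈ K` and the cell bijection `K₁ ∩ {σ ∈ 𝔭} → K₂`, `k ↦ w k`
  obtain ⟨wG, hwGm, hwG⟩ := HermitianLatticeTree.exists_mem_glInt_coe_eq_swap (F := F)
  set w : ↥(glInt 2 F) := ⟨wG, hwG⟩ with hw
  have hwmul : ∀ k : ↥(glInt 2 F), (((w * k : ↥(glInt 2 F)) : GL (Fin 2) F) : Matrix (Fin 2) (Fin 2) F) =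
      !![e10 k, ((k : GL (Fin 2) F) : Matrix (Fin 2) (Fin 2) F) 1 1; e00 k, ((k : GL (Fin 2) F) : Matrix (Fin 2) (Fin 2) F) 0 1] := fun k => by
    rw [Subgroup.coe_mul, Units.val_mul, hw]
    simp only
    rw [hwGm, swap_mul]
  -- masses
  have hO0 : dx (primePowBall F 0) ≠ 0 := ((isOpen_primePowBall 0).measure_pos dx ⟨0, zero_mem_primePowBall 0⟩).ne'
  have hOt : dx (primePowBall F 0) ≠ ⊤ := (isCompact_primePowBall 0).measure_lt_top.ne
  have hK₁open : IsOpen K₂ᶜ := ((isClosed_primePowBall 1).preimage he00c).isOpen_compl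
  have hK₁pos : κ K₂ᶜ ≠ 0 := by
    refine (hK₁open.measure_pos κ ⟨1, ?_⟩).ne'
    rw [Set.mem_compl_iff, hmemK₂, not_lt]
    simp [he00]
  have hK₁top : κ K₂ᶜ ≠ ⊤ := (measure_lt_top κ _).ne
  -- THE CONSTANT
  refine ⟨κ K₂ᶜ / dx (primePowBall F 0), (ENNReal.div_pos_iff.2 ⟨hK₁pos, hOt⟩).ne', ENNReal.div_ne_top hK₁top hO0, ?_⟩
  intro nl hnl hnlm nw hnw hnwm Ψ hΨm hΨ
  /- (1) the cell-`K₁` push-forward `m₁ = σ_* (κ|_{K₁})` is carried by `𝒪` and `𝒪`-translation invariant -/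
  set m₁ : Measure F := Measure.map σ (κ.restrict K₂ᶜ) with hm₁
  haveI : IsFiniteMeasure m₁ := by rw [hm₁]; infer_instance
  have hm₁app : ∀ A : Set F, MeasurableSet A → m₁ A = κ (σ ⁻¹' A ∩ K₂ᶜ) := fun A hA => by
    rw [hm₁, Measure.map_apply hσm hA, Measure.restrict_apply (hσm hA)]
  have hm₁O : m₁ (primePowBall F 0)ᶜ = 0 := by
    rw [hm₁app _ (isClosed_primePowBall 0).measurableSet.compl]
    convert measure_empty (μ := κ)
    ext k
    simp only [Set.mem_inter_iff, Set.mem_preimage, Set.mem_compl_iff, Set.mem_empty_iff_false, iff_false, not_and, not_not]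
    intro h
    by_contra hk
    exact h (hσO k hk)
  have hm₁inv : ∀ x ∈ primePowBall F 0, ∀ A : Set F, MeasurableSet A → m₁ ((fun y => y + x) ⁻¹' A) = m₁ A := by
    intro x hx A hA
    obtain ⟨U, hUm, hU⟩ := exists_glInt_lowerUni ((Valuation.mem_integer_iff _ _).1 (LocalFieldHaar.mem_primePowBall_zero_iff.1 hx))
    set u : ↥(glInt 2 F) := ⟨U, hU⟩ with hu
    have humul : ∀ k : ↥(glInt 2 F), (((u * k : ↥(glInt 2 F)) : GL (Fin 2) F) : Matrix (Fin 2) (Fin 2) F) =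
        !![e00 k, ((k : GL (Fin 2) F) : Matrix (Fin 2) (Fin 2) F) 0 1;
           x * e00 k + e10 k, x * ((k : GL (Fin 2) F) : Matrix (Fin 2) (Fin 2) F) 0 1 + ((k : GL (Fin 2) F) : Matrix (Fin 2) (Fin 2) F) 1 1] := fun k => by
      rw [Subgroup.coe_mul, Units.val_mul, hu]
      simp only
      rw [hUm, lowerUni_mul]
    rw [hm₁app _ ((measurable_add_const x) hA), hm₁app _ hA, ← measure_preimage_mul κ u (σ ⁻¹' A ∩ K₂ᶜ)]
    congr 1
    ext k
    have h00 : e00 (u * k) = e00 k := by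
      show (((u * k : ↥(glInt 2 F)) : GL (Fin 2) F) : Matrix (Fin 2) (Fin 2) F) 0 0 = e00 k
      rw [humul]; simp
    have h10 : e10 (u * k) = x * e00 k + e10 k := by
      show (((u * k : ↥(glInt 2 F)) : GL (Fin 2) F) : Matrix (Fin 2) (Fin 2) F) 1 0 = x * e00 k + e10 k
      rw [humul]; simp
    have hmem : u * k ∈ K₂ᶜ ↔ k ∈ K₂ᶜ := by
      simp only [Set.mem_compl_iff, hK₂, Set.mem_preimage, h00]
    have hσ' : k ∈ K₂ᶜ → σ (u * k) = σ k + x := fun hk => by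
      show e10 (u * k) / e00 (u * k) = e10 k / e00 k + x
      rw [h00, h10, add_div, mul_div_cancel_right₀ x (hne00 k hk), add_comm]
    simp only [Set.mem_preimage, Set.mem_inter_iff]
    rw [hmem]
    constructor
    · rintro ⟨hA', hk⟩
      exact ⟨by rw [hσ' hk]; exact hA', hk⟩
    · rintro ⟨hA', hk⟩
      exact ⟨by rw [← hσ' hk]; exact hA', hk⟩
  -- the averaging lemma: `m₁ = c • dx|_𝒪`
  have hm₁mass : m₁ (primePowBall F 0) = κ K₂ᶜ := by
    rw [hm₁app _ (isClosed_primePowBall 0).measurableSet]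
    congr 1
    ext k
    simp only [Set.mem_inter_iff, Set.mem_preimage, and_iff_right_iff_imp]
    exact hσO k
  have hm₁eq : m₁ = (κ K₂ᶜ / dx (primePowBall F 0)) • dx.restrict (primePowBall F 0) := by
    rw [← hm₁mass]; exact eq_smul_restrict_of_forall_preimage_add dx m₁ hm₁O hm₁inv
  /- (2) the cell-`K₂` push-forward `m₂ = τ_* (κ|_{K₂}) = m₁|_𝔭` (flip by `w`) -/
  set m₂ : Measure F := Measure.map τ (κ.restrict K₂) with hm₂
  have hm₂app : ∀ A : Set F, MeasurableSet A → m₂ A = κ (τ ⁻¹' A ∩ K₂) := fun A hA => by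
    rw [hm₂, Measure.map_apply hτm hA, Measure.restrict_apply (hτm hA)]
  have hP : MeasurableSet (primePowBall F 1) := (isClosed_primePowBall 1).measurableSet
  have hm₂eq : m₂ = (κ K₂ᶜ / dx (primePowBall F 0)) • dx.restrict (primePowBall F 1) := by
    have hres : m₂ = m₁.restrict (primePowBall F 1) := by
      ext A hA
      rw [Measure.restrict_apply hA, hm₂app A hA, hm₁app _ (hA.inter hP), ← measure_preimage_mul κ w (σ ⁻¹' (A ∩ primePowBall F 1) ∩ K₂ᶜ)]
      congr 1
      ext k
      simp only [Set.mem_preimage, Set.mem_inter_iff, Set.mem_compl_iff, hmemK₂, mem_primePowBall_one_iff, not_lt]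
      have h00 : e00 (w * k) = e10 k := by
        show (((w * k : ↥(glInt 2 F)) : GL (Fin 2) F) : Matrix (Fin 2) (Fin 2) F) 0 0 = e10 k
        rw [hwmul]; simp
      have h10 : e10 (w * k) = e00 k := by
        show (((w * k : ↥(glInt 2 F)) : GL (Fin 2) F) : Matrix (Fin 2) (Fin 2) F) 1 0 = e00 k
        rw [hwmul]; simp
      have hστ : σ (w * k) = τ k := by simp only [hσ, hτ]; rw [h00, h10]
      rw [hστ, h00]
      constructor
      · rintro ⟨hA', hk⟩
        have h1 : valuation F (e10 k) = 1 := hK₂unit k ((hmemK₂ k).2 hk)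
        refine ⟨⟨hA', ?_⟩, h1.ge⟩
        simp only [hτ]; rw [map_div₀, h1, div_one]; exact hk
      · rintro ⟨⟨hA', hτP⟩, h1⟩
        refine ⟨hA', ?_⟩
        have h1' : valuation F (e10 k) = 1 := le_antisymm (valuation_apply_le_one k.2 1 0) h1
        have : valuation F (τ k) = valuation F (e00 k) := by simp only [hτ]; rw [map_div₀, h1', div_one]
        rw [← this]; exact hτP
    rw [hres, hm₁eq, Measure.restrict_smul, Measure.restrict_restrict hP,
      Set.inter_eq_left.2 (primePowBall_antitone (show (0 : ℤ) ≤ 1 by norm_num))]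
  /- (3) `Ψ` is read off the cell coordinate -/
  have hnlK : ∀ s ∈ primePowBall F 0, nl s ∈ glInt 2 F := fun s hs =>
    mem_glInt_of_isIntegralMatrix (by
      intro i j; rw [hnl]
      fin_cases i <;> fin_cases j
      · exact one_mem _
      · exact zero_mem _
      · exact LocalFieldHaar.mem_primePowBall_zero_iff.1 hs
      · exact one_mem _) (by rw [hnl, Matrix.det_fin_two_of]; simp)
  have hnwK : ∀ t ∈ primePowBall F 0, nw t ∈ glInt 2 F := fun t ht =>
    mem_glInt_of_isIntegralMatrix (by
      intro i j; rw [hnw]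
      fin_cases i <;> fin_cases j
      · exact LocalFieldHaar.mem_primePowBall_zero_iff.1 ht
      · exact one_mem _
      · exact one_mem _
      · exact zero_mem _) (by rw [hnw, Matrix.det_fin_two_of]; simp)
  have hΨ₁ : ∀ k : ↥(glInt 2 F), k ∈ K₂ᶜ → Ψ (k : GL (Fin 2) F) = Ψ (nl (σ k)) := fun k hk =>
    apply_eq_apply_lowerUni hΨ k.2 (hnlK _ (hσO k hk)) (hne00 k hk) (hnl _)
  have hτO : ∀ k : ↥(glInt 2 F), k ∈ K₂ → τ k ∈ primePowBall F 0 := fun k hk => by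
    rw [LocalFieldHaar.mem_primePowBall_zero_iff, Valuation.mem_integer_iff, hτ]
    simp only
    rw [map_div₀, hK₂unit k hk, div_one]
    exact valuation_apply_le_one k.2 0 0
  have hΨ₂ : ∀ k : ↥(glInt 2 F), k ∈ K₂ → Ψ (k : GL (Fin 2) F) = Ψ (nw (τ k)) := fun k hk =>
    apply_eq_apply_swapT hΨ k.2 (hnwK _ (hτO k hk)) (hne10 k hk) (hnw _)
  /- (4) assembly -/
  have hmap₁ : ∫⁻ k in K₂ᶜ, Ψ (nl (σ k)) ∂κ = ∫⁻ s, Ψ (nl s) ∂m₁ := by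
    rw [hm₁, lintegral_map (show Measurable fun s => Ψ (nl s) from hΨm.comp hnlm) hσm]
  have hmap₂ : ∫⁻ k in K₂, Ψ (nw (τ k)) ∂κ = ∫⁻ t, Ψ (nw t) ∂m₂ := by
    rw [hm₂, lintegral_map (show Measurable fun t => Ψ (nw t) from hΨm.comp hnwm) hτm]
  have hI₁ : ∫⁻ k in K₂ᶜ, Ψ (k : GL (Fin 2) F) ∂κ = (κ K₂ᶜ / dx (primePowBall F 0)) * ∫⁻ s in primePowBall F 0, Ψ (nl s) ∂dx := by
    rw [setLIntegral_congr_fun hK₁m hΨ₁, hmap₁, hm₁eq, lintegral_smul_measure, smul_eq_mul]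
  have hI₂ : ∫⁻ k in K₂, Ψ (k : GL (Fin 2) F) ∂κ = (κ K₂ᶜ / dx (primePowBall F 0)) * ∫⁻ t in primePowBall F 1, Ψ (nw t) ∂dx := by
    rw [setLIntegral_congr_fun hK₂m hΨ₂, hmap₂, hm₂eq, lintegral_smul_measure, smul_eq_mul]
  rw [← lintegral_add_compl _ hK₂m, hI₁, hI₂, mul_add, add_comm]

end Cells

/-! ## §2  Concrete parametrisations `n⁻(s) = mkOfDetNeZero [[1,0],[s,1]]`, `w(t) = mkOfDetNeZero [[t,1],[1,0]]` and the head in that spelling -/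

section Concrete
variable [TopologicalSpace F] [IsNonarchimedeanLocalField F]

omit [ValuativeRel F] [TopologicalSpace F] [IsNonarchimedeanLocalField F] in
/-- `det [[1,0],[s,1]] ≠ 0`. [folklore] -/
theorem det_lowerUni_ne_zero (s : F) : (!![1, 0; s, 1] : Matrix (Fin 2) (Fin 2) F).det ≠ 0 := by
  rw [Matrix.det_fin_two_of]; simp

omit [ValuativeRel F] [TopologicalSpace F] [IsNonarchimedeanLocalField F] in
/-- `det [[t,1],[1,0]] ≠ 0`. [folklore] -/
theorem det_swapT_ne_zero (t : F) : (!![t, 1; 1, 0] : Matrix (Fin 2) (Fin 2) F).det ≠ 0 := by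
  rw [Matrix.det_fin_two_of]; simp

omit [ValuativeRel F] [IsNonarchimedeanLocalField F] in
/-- `s ↦ n⁻(s) = [[1,0],[s,1]]` is continuous into `GL₂(F)` (its inverse `[[1,0],[−s,1]]` is continuous too). [folklore] -/
theorem continuous_lowerUniGL [IsTopologicalRing F] :
    Continuous fun s : F => Matrix.GeneralLinearGroup.mkOfDetNeZero (!![1, 0; s, 1] : Matrix (Fin 2) (Fin 2) F) (det_lowerUni_ne_zero s) := by
  refine Units.continuous_iff.2 ⟨?_, ?_⟩
  · show Continuous fun s : F => (!![1, 0; s, 1] : Matrix (Fin 2) (Fin 2) F)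
    refine continuous_matrix fun i j => ?_
    fin_cases i <;> fin_cases j <;> simp <;> fun_prop
  · have h : ∀ s : F, ((((Matrix.GeneralLinearGroup.mkOfDetNeZero (!![1, 0; s, 1] : Matrix (Fin 2) (Fin 2) F) (det_lowerUni_ne_zero s))⁻¹ :
        GL (Fin 2) F)) : Matrix (Fin 2) (Fin 2) F) = !![1, 0; -s, 1] := fun s => by
      rw [Matrix.coe_units_inv]
      exact Matrix.inv_eq_left_inv (lowerUni_neg_mul_lowerUni s)
    have hfun : (fun s : F => ((((Matrix.GeneralLinearGroup.mkOfDetNeZero (!![1, 0; s, 1] : Matrix (Fin 2) (Fin 2) F) (det_lowerUni_ne_zero s))⁻¹ :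
        GL (Fin 2) F)) : Matrix (Fin 2) (Fin 2) F)) = fun s => !![1, 0; -s, 1] := funext h
    rw [hfun]
    refine continuous_matrix fun i j => ?_
    fin_cases i <;> fin_cases j <;> simp <;> fun_prop

omit [ValuativeRel F] [IsNonarchimedeanLocalField F] in
/-- `t ↦ w(t) = [[t,1],[1,0]]` is continuous into `GL₂(F)` (inverse `[[0,1],[1,−t]]`). [folklore] -/
theorem continuous_swapTGL [IsTopologicalRing F] :
    Continuous fun t : F => Matrix.GeneralLinearGroup.mkOfDetNeZero (!![t, 1; 1, 0] : Matrix (Fin 2) (Fin 2) F) (det_swapT_ne_zero t) := by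
  refine Units.continuous_iff.2 ⟨?_, ?_⟩
  · show Continuous fun t : F => (!![t, 1; 1, 0] : Matrix (Fin 2) (Fin 2) F)
    refine continuous_matrix fun i j => ?_
    fin_cases i <;> fin_cases j <;> simp <;> fun_prop
  · have h : ∀ t : F, ((((Matrix.GeneralLinearGroup.mkOfDetNeZero (!![t, 1; 1, 0] : Matrix (Fin 2) (Fin 2) F) (det_swapT_ne_zero t))⁻¹ :
        GL (Fin 2) F)) : Matrix (Fin 2) (Fin 2) F) = !![0, 1; 1, -t] := fun t => by
      rw [Matrix.coe_units_inv]
      exact Matrix.inv_eq_left_inv (swapInv_mul_swapT t)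
    have hfun : (fun t : F => ((((Matrix.GeneralLinearGroup.mkOfDetNeZero (!![t, 1; 1, 0] : Matrix (Fin 2) (Fin 2) F) (det_swapT_ne_zero t))⁻¹ :
        GL (Fin 2) F)) : Matrix (Fin 2) (Fin 2) F)) = fun t => !![0, 1; 1, -t] := funext h
    rw [hfun]
    refine continuous_matrix fun i j => ?_
    fin_cases i <;> fin_cases j <;> simp <;> fun_prop

variable [MeasurableSpace F] [BorelSpace F] [MeasurableSpace (GL (Fin 2) F)] [BorelSpace (GL (Fin 2) F)]

/-- **BRUHAT-CELL INTEGRATION ON `GL₂(𝒪)`, CONCRETE SPELLING**: with `n⁻(s) = mkOfDetNeZero [[1,0],[s,1]] _` and `w(t) = mkOfDetNeZero [[t,1],[1,0]] _`,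
`∃ c ∈ (0,∞), ∀ Ψ` measurable and right-`B(𝒪)`-invariant on `K`, `∫⁻_K Ψ dκ = c · (∫⁻_{s ∈ 𝒪} Ψ(n⁻ s) dx + ∫⁻_{t ∈ 𝔭} Ψ(w t) dx)`.
[cite: Serre1980Trees, Ch. II §1.1] [cite: IwahoriMatsumoto1965, §2 Prop. 2.4] [cite: Folland1995, §2.2 Thm. 2.20, §2.6 Thm. 2.49] -/
theorem lintegral_glInt_eq_bruhatCells_mkOfDetNeZero (κ : Measure ↥(glInt 2 F)) [κ.IsHaarMeasure] (dx : Measure F) [dx.IsAddHaarMeasure] :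
    ∃ c : ℝ≥0∞, c ≠ 0 ∧ c ≠ ⊤ ∧ ∀ Ψ : GL (Fin 2) F → ℝ≥0∞, Measurable Ψ →
      (∀ k ∈ glInt 2 F, ∀ b ∈ glInt 2 F, ((b : GL (Fin 2) F) : Matrix (Fin 2) (Fin 2) F) 1 0 = 0 → Ψ (k * b) = Ψ k) →
      ∫⁻ k, Ψ (k : GL (Fin 2) F) ∂κ =
        c * ((∫⁻ s in primePowBall F 0, Ψ (Matrix.GeneralLinearGroup.mkOfDetNeZero (!![1, 0; s, 1] : Matrix (Fin 2) (Fin 2) F) (det_lowerUni_ne_zero s)) ∂dx) +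
          ∫⁻ t in primePowBall F 1, Ψ (Matrix.GeneralLinearGroup.mkOfDetNeZero (!![t, 1; 1, 0] : Matrix (Fin 2) (Fin 2) F) (det_swapT_ne_zero t)) ∂dx) := by
  haveI : IsTopologicalRing F := inferInstance
  obtain ⟨c, hc0, hct, h⟩ := lintegral_glInt_eq_bruhatCells κ dx
  exact ⟨c, hc0, hct, fun Ψ hΨm hΨ =>
    h _ (fun _ => rfl) continuous_lowerUniGL.measurable _ (fun _ => rfl) continuous_swapTGL.measurable Ψ hΨm hΨ⟩

end Concrete

end Summit.HodgeConjecture.HodgeConjecture.Cruxes.H413.K2E3GL2IntegralPointsBruhatCells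

end
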